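import Summits.BirchSwinnertonDyer.Rank1Residual.X11b.KolyvaginH44LocalizedCore
import Summits.BirchSwinnertonDyer.BirchSwinnertonDyer.Theorems.SylvesterTwoHeegnerIndexUpperOffV0LocalCriterionOfKerChi
import Summits.BirchSwinnertonDyer.BirchSwinnertonDyer.Theorems.SylvesterTwoHeegnerIndexUpperOffV0ReductionDatumSupersingular
import HarnessLib

/-!
# K7t crux `UpperOffV0HSYPlus` (item 19804), line `offv0-kolyvagin2`, the `2`-adic local clause `h44`,
# layer 1: x11b3's core `h44`-from-Prop-3.7 theorem at SUPERSINGULAR Kolyvagin primes, any prime `p`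

Helper file of route `SylvesterTwoHeegnerIndex` (cell bsd-cm, rung K7t).  x11b3's
`KolyvaginH44.h44_of_prop37_of_ringClassDecomposition_on` (`X11b/KolyvaginH44LocalizedCore`) derives
McCallum's local clause `h44` at `λ ∣ m` from Gross's Prop. 3.7 (`h37`), the splitting of `λ` in
`K_{m/ℓ}` (`hsplit`) and the total ramification of `λ` in `K_m/K_{m/ℓ}` (`hram`) for an ODD prime `p`
with the Weil pairing; `p ≠ 2` / `hW` are used ONLY through `exists_reductionDatum` (cyclic
eigenspaces) and the tree's local criterion.  THIS FILE is the same theorem for ANY prime `p`, with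
those two calls replaced by k7t-c2 g6's `exists_reductionDatum_of_frobeniusTrace_eq_zero` and
`zsmul_kolyvaginClass_mem_selmerLocalKer_iff_of_isKolyvaginPrime_of_kerChi`, under the extra labelled
input `hss` : **`a_ℓ(W) = 0` at the Kolyvagin primes `ℓ` in play** (for the Sylvester curves `E_p` at
`2`: every Kolyvagin prime is `≡ 2 (mod 3)` and `j = 0`, so `a_ℓ = 0` by the tree's
`frobeniusTrace_eq_zero_of_j_eq_zero_of_mod_three_eq_two` — the congruence itself is not derived here).

* `h44_of_prop37_of_ringClassDecomposition_on_of_supersingular` — token for token x11b3's statement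
  with `(hp2) (hW)` replaced by `hss`; proof verbatim except the two calls and `a' = 0`.

HONEST FRAMING: x11b3's mathematics and text (credited there); `h37`, `hsplit`, `hram`, `hss` are
labelled hypotheses; nothing discharged; no definition, no named fact, no `sorry`; B14 = O12 open as a
class; BSD not claimed.  References: [McCallumLMS1991] Prop. 4.4, Lemma 4.3; [GrossLMS1991] Prop. 3.7,
Prop. 6.2 (2), §3 (3.1)–(3.4).
-/

set_option autoImplicit false
set_option linter.dupNamespace false

noncomputable section

open scoped Classical Pointwise
open WeierstrassCurve Field NumberField IsDedekindDomain Finset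
open Literature.NumberTheory.EllipticCurves Literature.NumberTheory.GaloisRepresentations
open Literature.NumberTheory.EllipticCurves.KolyvaginCocycle
open Literature.NumberTheory.EllipticCurves.KolyvaginEuler
open Rat.HeightOneSpectrum
open Summit.BirchSwinnertonDyer.Rank1Residual.X11b
open Summit.BirchSwinnertonDyer.Rank1Residual.X11b.KolyvaginH44

universe u

namespace Summit.BirchSwinnertonDyer.BirchSwinnertonDyer.Theorems.SylvesterTwoUpper

variable {K : Type u} [Field K] [NumberField K]

/-- **`h44` at the levels `R` from Gross's Prop. 3.7, the splitting and the total ramification data —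
at SUPERSINGULAR Kolyvagin primes (`a_ℓ = 0`, labelled `hss`), for ANY prime `p`** (x11b3's
`h44_of_prop37_of_ringClassDecomposition_on` with `p ≠ 2` and the Weil pairing replaced by `hss`; the
reduction datum is `exists_reductionDatum_of_frobeniusTrace_eq_zero`, the local criterion
`…_of_isKolyvaginPrime_of_kerChi`, the Euler root has `a' = 0`).
[cite: McCallumLMS1991, Prop. 4.4, Lemma 4.3, §4 (p. 282 l. 1)] [cite: GrossLMS1991, Prop. 3.7, Prop. 6.2 (2), §3 (3.1)–(3.4)] -/
theorem h44_of_prop37_of_ringClassDecomposition_on_of_supersingular {N : ℕ} [NeZero N] {W : WeierstrassCurve ℚ}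
    [W.IsElliptic] [W.IsGloballyMinimal] (hK : IsImaginaryQuadratic K)
    {P : (W.baseChange K).toAffine.Point} (hHP : IsHeegnerPoint N W K P)
    {p M : ℕ} (hp : p.Prime) (hM : 1 ≤ M)
    (hss : ∀ ℓ : ℕ, IsKolyvaginPrime N W K p ℓ → FrobEqFrobInfty W K (p ^ M) ℓ →
      W.frobeniusTrace ℓ = 0)
    (hdiv : ∀ Q : geomPoints (W.baseChange K), ∃ R, ((p ^ M : ℕ) : ℤ) • R = Q)
    {𝒢 : ℕ → Type*} [∀ m, CommGroup (𝒢 m)] {A₀ : ℕ → Type*} [∀ m, AddCommGroup (A₀ m)]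
    [∀ m, DistribMulAction (𝒢 m) (A₀ m)]
    (σ : ∀ m, ℕ → 𝒢 m) (L : ℕ → Finset ℕ) (H : ∀ m, Subgroup (𝒢 m))
    [∀ m, Fintype (𝒢 m ⧸ H m)] (f : ∀ m, 𝒢 m ⧸ H m → 𝒢 m)
    (hord : ∀ m, ∀ ℓ ∈ L m, σ m ℓ ^ (ℓ + 1) = 1)
    (y : ∀ m, A₀ m)
    (π : ∀ m, absoluteGaloisGroup K →* 𝒢 m) (j : ∀ m, A₀ m →+ geomPoints (W.baseChange K))
    (hj : ∀ m (g : absoluteGaloisGroup K) (a : A₀ m), j m (π m g • a) = g • j m a)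
    (hA : ∀ m, IsAdmissible (absoluteGaloisGroup K) (j m).range ((p ^ M : ℕ) : ℤ))
    (hPt : ∀ m, j m (kolyvaginPoint (σ m) (L m) (f m) (y m)) ∈
      invPoints (absoluteGaloisGroup K) (j m).range ((p ^ M : ℕ) : ℤ))
    (hI : ∀ m : ℕ, ∀ v : HeightOneSpectrum (𝓞 K), (m : 𝓞 K) ∉ v.asIdeal →
      ∀ 𝔐 ∈ v.localPrimesAbove, ∀ t ∈ 𝔐.inertia (absoluteGaloisGroup (v.adicCompletion K)),
        resGal (K := K) (v.adicCompletion K) t • j m (kolyvaginPoint (σ m) (L m) (f m) (y m)) =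
          j m (kolyvaginPoint (σ m) (L m) (f m) (y m)))
    (R : ℕ → Prop)
    (h37 : ∀ m : ℕ, R m → Squarefree m →
      (∀ q ∈ m.primeFactors, IsKolyvaginPrime N W K p q ∧ FrobEqFrobInfty W K (p ^ M) q) →
      ∀ ℓ : ℕ, ℓ.Prime → ℓ ∣ m →
      ℓ ∈ L m ∧ ∃ y' : A₀ m,
        j m (kolyvaginPoint (σ m) ((L m).erase ℓ) (f m) y') =
          j (m / ℓ) (kolyvaginPoint (σ (m / ℓ)) (L (m / ℓ)) (f (m / ℓ)) (y (m / ℓ))) ∧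
        grAct (A₀ m) (traceElt (σ m ℓ) ℓ) (y m) = W.frobeniusTrace ℓ • y' ∧
        ∀ [Fact ℓ.Prime] (hΔ : ¬ (ℓ : ℤ) ∣ minimalDiscriminantInt W)
          (φ₀ : absoluteGaloisGroup (ZMod ℓ)), (∀ x : AlgebraicClosure (ZMod ℓ), φ₀ • x = x ^ ℓ) →
          ∀ γ : 𝒢 m, geomReduction hΔ ((RatClosure.pointsEquiv (K := K) W).symm (j m (γ • y m))) =
            φ₀ • geomReduction hΔ ((RatClosure.pointsEquiv (K := K) W).symm (j m (γ • y'))))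
    (hsplit : ∀ m : ℕ, R m → Squarefree m →
      (∀ q ∈ m.primeFactors, IsKolyvaginPrime N W K p q ∧ FrobEqFrobInfty W K (p ^ M) q) →
      ∀ ℓ : ℕ, ℓ.Prime → ℓ ∣ m → ∀ v : HeightOneSpectrum (𝓞 K), (ℓ : 𝓞 K) ∈ v.asIdeal →
      ∀ 𝔓 ∈ v.primesAbove, ∀ F : absoluteGaloisGroup K, IsArithFrobAt (𝓞 K) F 𝔓 →
        F • j (m / ℓ) (kolyvaginPoint (σ (m / ℓ)) (L (m / ℓ)) (f (m / ℓ)) (y (m / ℓ))) =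
          j (m / ℓ) (kolyvaginPoint (σ (m / ℓ)) (L (m / ℓ)) (f (m / ℓ)) (y (m / ℓ))))
    (hram : ∀ m : ℕ, R m → Squarefree m →
      (∀ q ∈ m.primeFactors, IsKolyvaginPrime N W K p q ∧ FrobEqFrobInfty W K (p ^ M) q) →
      ∀ ℓ : ℕ, ℓ.Prime → ℓ ∣ m → ∀ v : HeightOneSpectrum (𝓞 K), (ℓ : 𝓞 K) ∈ v.asIdeal →
      ∀ 𝔓 ∈ v.primesAbove, ∃ τ₀ ∈ 𝔓.inertia (absoluteGaloisGroup K), π m τ₀ = σ m ℓ ∧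
        ∀ τ ∈ 𝔓.inertia (absoluteGaloisGroup K), ∃ i : ℕ, ∀ x ∈ (j m).range,
          τ • x = (τ₀ ^ i) • x) :
    ∀ m : ℕ, R m → Squarefree m →
      (∀ q ∈ m.primeFactors, IsKolyvaginPrime N W K p q ∧ FrobEqFrobInfty W K (p ^ M) q) →
      ∀ ℓ : ℕ, ℓ.Prime → ℓ ∣ m → ∀ v : HeightOneSpectrum (𝓞 K), (ℓ : 𝓞 K) ∈ v.asIdeal →
        ∀ a : ℕ, (((p : ℤ) ^ a) • kolyvaginClass (W.baseChange K) _ hdiv (hA m)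
              (j m (kolyvaginPoint (σ m) (L m) (f m) (y m))) (hPt m) ∈
            selmerLocalKer (W.baseChange K) (v.adicCompletion K) ((p ^ M : ℕ) : ℤ) ↔
          ((p : ℤ) ^ a) • kolyvaginClass (W.baseChange K) _ hdiv (hA (m / ℓ))
              (j (m / ℓ) (kolyvaginPoint (σ (m / ℓ)) (L (m / ℓ)) (f (m / ℓ)) (y (m / ℓ))))
              (hPt (m / ℓ)) ∈
            (W.baseChange K).torsionLocalKer (v.adicCompletion K) ((p ^ M : ℕ) : ℤ)) := by
  intro m hRm hm hkol ℓ hℓp hℓm v hv a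
  have hm0 : m ≠ 0 := Squarefree.ne_zero hm
  have hℓmem : ℓ ∈ m.primeFactors := Nat.mem_primeFactors.mpr ⟨hℓp, hℓm, hm0⟩
  obtain ⟨hℓ, hℓM⟩ := hkol ℓ hℓmem
  haveI : Fact ℓ.Prime := ⟨hℓp⟩
  haveI : Fact p.Prime := ⟨hp⟩
  have hvpl : v = hℓ.place := hℓ.mem_iff.mp hv
  have hpℓ : p ≠ ℓ := fun h ↦ hℓ.2.2.2.1 h.symm
  have hℓpM : ¬ ℓ ∣ p ^ M := fun h ↦
    hpℓ ((Nat.prime_dvd_prime_iff_eq hℓp hp).mp (hℓp.dvd_of_dvd_pow h)).symm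
  have hpM0 : p ^ M ≠ 0 := pow_ne_zero M hp.ne_zero
  -- good reduction at `λ` and at the place `v₀ = (ℓ)` of `ℚ`; `ℓ ∤ Δ_W`
  have hgood : (W.baseChange K).HasGoodReductionAt v := by
    have h := hℓ.not_mem_badPlaces hHP
    rw [mem_badPlaces_iff, not_not] at h
    rwa [hvpl]
  obtain ⟨v₀, hv₀, hℓv₀⟩ := exists_ratPlace ℓ
  have hgood₀ : W.HasGoodReductionAt v₀ := hℓ.hasGoodReductionAt_rat hHP v₀ hℓv₀
  have hΔ : ¬ (ℓ : ℤ) ∣ minimalDiscriminantInt W := by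
    have h1 := (hasGoodReductionAtPrime_iff_hasGoodReductionAt_ringOfIntegers v₀ W).mpr hgood₀
    have h2 := @not_dvd_minimalDiscriminantInt_of_hasGoodReductionAtPrime' W _
      (primesEquiv v₀ : ℕ) (Fact.mk (primesEquiv v₀).2) h1
    rwa [hv₀] at h2
  -- `p^M ∣ ℓ + 1`; `a_ℓ = 0` (supersingular Kolyvagin prime, labelled input `hss`)
  obtain ⟨-, l', hl'⟩ := IsKolyvaginPrime.pow_dvd_add_one W hp hℓ hM hℓM
  have ha0 : W.frobeniusTrace ℓ = 0 := hss ℓ hℓ hℓM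
  -- the inert place: uniqueness and `q_λ = ℓ²`
  have huniq : ∀ w : HeightOneSpectrum (𝓞 K), (ℓ : 𝓞 K) ∈ w.asIdeal → w = v :=
    fun w hw ↦ (hℓ.mem_iff.mp hw).trans hvpl.symm
  have hres : v.residueCard = ℓ ^ 2 := by rw [hvpl]; exact residueCard_place_eq_sq hK hℓ
  -- the Frobenius of `𝔽̄_ℓ`
  obtain ⟨φ₀, hφ₀'⟩ := exists_frobenius_absoluteGaloisGroup (ZMod ℓ)
  have hφ₀ : ∀ x : AlgebraicClosure (ZMod ℓ), φ₀ • x = x ^ ℓ := fun x ↦ by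
    rw [hφ₀' x, Nat.card_zmod]
  -- Prop. 3.7 at `(m, ℓ)` and the inter-level lift
  obtain ⟨hℓL, y', hy'P, hrel, hES⟩ := h37 m hRm hm hkol ℓ hℓp hℓm
  -- the Selmer condition of `c_M(m/ℓ)` at the good place `λ ∤ m/ℓ` (McCallum Lemma 4.3)
  have hmv : ((m / ℓ : ℕ) : 𝓞 K) ∉ v.asIdeal := by
    intro h
    rw [hvpl] at h
    have hdvd := dvd_of_natCast_mem_place hℓ hv₀ hℓv₀ h
    have : ℓ * ℓ ∣ m := by
      have := Nat.mul_dvd_mul_left ℓ hdvd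
      rwa [Nat.mul_div_cancel' hℓm] at this
    exact hℓp.one_lt.ne' (Nat.isUnit_iff.mp (hm ℓ this))
  obtain ⟨𝔐, h𝔐⟩ := v.localPrimesAbove_nonempty
  have hsel₂ := Three.GrossBadPlace.kolyvaginClass_mem_selmerLocalKer_of_inertia_of_hasGoodReductionAt
    (W.baseChange K)
    (hdiv := hdiv) (hA (m / ℓ)) (hPt (m / ℓ)) v hgood h𝔐 (hI (m / ℓ) v hmv 𝔐 h𝔐)
  -- McCallum Prop. 4.4 in order form, from the reduction datum
  refine zsmul_kolyvaginClass_mem_selmerLocalKer_iff_of_isKolyvaginPrime_of_kerChi W hK hp hℓ hℓM hv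
    hgood (hA m) (hA (m / ℓ)) (hPt m) (hPt (m / ℓ)) hsel₂ (l' := l') (a' := 0) ?_ _
  intro 𝔓 h𝔓 F hF hFfix
  refine ⟨hsplit m hRm hm hkol ℓ hℓp hℓm v hv 𝔓 h𝔓 F hF, ?_⟩
  obtain ⟨g, red, φ, hredg, hφ, hredI, hredF, hred, hBn, hχ⟩ :=
    exists_reductionDatum_of_frobeniusTrace_eq_zero W hΔ hl' ha0 hφ₀ hv huniq hres h𝔓 hℓpM hpM0
      hF hFfix
  obtain ⟨τ₀, hτ₀I, hπτ₀, hIτ₀⟩ := hram m hRm hm hkol ℓ hℓp hℓm v hv 𝔓 h𝔓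
  -- Prop. 3.7 (2) for the reduction along `𝔓`
  have hES' : ∀ γ : 𝒢 m, red (j m (γ • y m)) = φ (red (j m (γ • y'))) := by
    intro γ
    rw [hredg, hredg, hφ, ← hj, ← hj, ← mul_smul, ← mul_smul]
    exact hES hΔ φ₀ hφ₀ _
  -- the Euler-system root at `λ`
  have hlZ : ((ℓ + 1 : ℕ) : ℤ) = ((p ^ M : ℕ) : ℤ) * l' := by rw [hl']; push_cast; ring
  have haZ : W.frobeniusTrace ℓ = ((p ^ M : ℕ) : ℤ) * 0 := by rw [ha0, mul_zero]
  obtain ⟨R₀, hR₀A, hR₀, hR₀red⟩ := exists_root_of_relation (π m) (j m) (hj m) hℓL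
    (hord m ℓ hℓL) (f m) hrel hlZ haZ hπτ₀ red φ hES'
  rw [hy'P] at hR₀red
  -- lift `B = Ẽ(𝔽̄_ℓ)` to the universe of `K`
  set e : ULift.{u} (reductionModPrime W ℓ).geomPoints ≃+ (reductionModPrime W ℓ).geomPoints :=
    AddEquiv.ulift with he
  set redL : geomPoints (W.baseChange K) →+ ULift.{u} (reductionModPrime W ℓ).geomPoints :=
    e.symm.toAddMonoidHom.comp red with hredLdef
  set φL : ULift.{u} (reductionModPrime W ℓ).geomPoints →+
      ULift.{u} (reductionModPrime W ℓ).geomPoints :=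
    e.symm.toAddMonoidHom.comp (φ.comp e.toAddMonoidHom) with hφLdef
  have hredL : ∀ x, redL x = e.symm (red x) := fun _ ↦ rfl
  have hφL : ∀ b, φL b = e.symm (φ (e b)) := fun _ ↦ rfl
  refine ⟨ULift.{u} (reductionModPrime W ℓ).geomPoints, inferInstance, redL, φL, τ₀, R₀, ?_, ?_, ?_,
    ?_, ?_, hτ₀I, hIτ₀, hR₀A, hR₀, ?_⟩
  · intro τ hτ x
    rw [hredL, hredL, hredI τ hτ x]
  · intro x
    rw [hredL, hφL, hφL, hredL, AddEquiv.apply_symm_apply, AddEquiv.apply_symm_apply, hredF x]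
  · intro x hx h0
    rw [hredL, AddEquiv.map_eq_zero_iff] at h0
    exact hred x hx h0
  · intro b hb
    have hb' : (((p ^ M : ℕ) : ℤ)) • e b = 0 := by rw [← map_zsmul, hb, map_zero]
    rw [hφL, hφL, AddEquiv.apply_symm_apply, hBn _ hb', AddEquiv.symm_apply_apply]
  · -- `ker χ_ℓ = p^M Ẽ(F_λ)` transported along `ULift`
    intro b hb
    have hb' : φ (φ (e b)) = e b := by
      have := congrArg e hb
      rwa [hφL, hφL, AddEquiv.apply_symm_apply, AddEquiv.apply_symm_apply] at this
    have key := hχ (e b) hb'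
    constructor
    · intro h0
      have h0' : (0 : ℤ) • e b - l' • φ (e b) = 0 := by
        have := congrArg e h0
        rwa [map_sub, map_zsmul, map_zsmul, hφL, AddEquiv.apply_symm_apply, map_zero] at this
      obtain ⟨y, hy, hyb⟩ := key.mp h0'
      refine ⟨e.symm y, ?_, ?_⟩
      · rw [hφL, hφL, AddEquiv.apply_symm_apply, AddEquiv.apply_symm_apply, hy]
      · apply e.injective
        rw [map_zsmul, AddEquiv.apply_symm_apply, hyb]
    · rintro ⟨y, hy, hyb⟩
      have hy' : φ (φ (e y)) = e y := by
        have := congrArg e hy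
        rwa [hφL, hφL, AddEquiv.apply_symm_apply, AddEquiv.apply_symm_apply] at this
      have hyb' : ((p : ℤ) ^ M) • e y = e b := by rw [← map_zsmul, hyb]
      have h := key.mpr ⟨e y, hy', hyb'⟩
      apply e.injective
      rw [map_sub, map_zsmul, map_zsmul, hφL, AddEquiv.apply_symm_apply, map_zero]
      exact h
  · rw [hredL, hredL, hφL, AddEquiv.apply_symm_apply, hR₀red, map_sub, map_zsmul, map_zsmul]

end Summit.BirchSwinnertonDyer.BirchSwinnertonDyer.Theorems.SylvesterTwoUpper

end
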